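import Mathlib
import HarnessLib
import Summits.AtomisticToContinuum.FouriersLaw.Theses.JunctionLocality
import Summits.AtomisticToContinuum.FouriersLaw.Theorems.JunctionLocalityConductanceLowerBoundStubKuboLinkAux3
import Summits.AtomisticToContinuum.FouriersLaw.Theorems.OddSectorIrreversibilityCorrectorTheoryUniformMixing

/-!
# The Kubo link (stub `stub_kuboLink` of lines `far-contact-fisher-square`, `ForecastSensitivitySketch`,
`cold-bath-relocation-walk`; crux stmt-AtomisticToContinuum-11749 `JunctionLocality.ConductanceLowerBound`) — PROVED

The finite-volume Kubo formula for the crux's response coefficient along the unique weak steady-state family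
of the pinned anharmonic chain `pinnedChain ω₂ lam β γ` (all parameters `> 0`), `T > 0`, `L ≥ 2`: for every
classical mean-zero `C² ∩ L²(μ_T)` forward field `g` of the LEFT bath (`L_{T,T} g = −(p_0² − T)`),

  `D_L/(L−1) = γ(1 − (γ/T²)⟨g, p_0² − T⟩_{μ_T})`

(Rey-Bellet 2003, Rem. 4.4; Kundu–Dhar–Narayan 2009).  This is the SHARED fixed-`N` stub of the three
crux-plan lines on this crux (byte-identical signature).  Proof: the landed conditional form
`stub_kuboLink_of_uniformMixingAt` (helper III, `…StubKuboLinkAux3.lean`: energy balance of the weak NESS,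
linear response of `⟨p_0² − T⟩_δ` from the exact response identity, kernel continuity, the odd-moment Kubo
identification and the landed row sum) needs ONE analytic input — CEHR 2018 (2.5) for the transition
semigroups with baths at `T ± δ/2` with constants UNIFORM in `|δ| < δ₀` — and that input is now a theorem of
the tree: `OddSectorIrreversibility.Corrector.pinnedChain_uniformMixing`
(`…OddSectorIrreversibilityCorrectorTheoryUniformMixing.lean`: uniform drift, uniform local minorisation +
reach, uniform Harris).  No definitions, no named facts, no hypotheses beyond the stub's signature.
-/

noncomputable section

open MeasureTheory Filter Topology
open scoped ContDiff
open Literature.MathematicalPhysics.KineticTheory.HeatConduction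
open Summit.AtomisticToContinuum.FouriersLaw.Theorems.SuperadditiveResistance.DeviceLiouville (kin)

namespace Summit.AtomisticToContinuum.FouriersLaw.Cruxes.ConductanceLowerBound.ForecastSensitivity

/-- **KUBO LINK** (stub `stub_kuboLink`, fixed `N`; shared by lines `far-contact-fisher-square`,
`ForecastSensitivitySketch`, `cold-bath-relocation-walk` of crux stmt-AtomisticToContinuum-11749).  For the
pinned anharmonic chain (all parameters `> 0`), `T > 0`, under weak-NESS uniqueness, along every steady-state
family `μ` with response coefficients `D` at `T`: for every `L ≥ 2` and every classical mean-zero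
`C² ∩ L²(μ_T)` solution `g` of `L_{T,T} g = −(p_0² − T)`,
`D_L/(L−1) = γ(1 − (γ/T²) ∫ g·(p_0² − T) dμ_T)`.  Proof: `pinnedChain_uniformMixing` (δ-uniform CEHR (2.5)
near equilibrium) discharges the hypothesis of `stub_kuboLink_of_uniformMixingAt`.
[cite: ReyBellet2003, Rem. 4.4] [cite: KunduDharNarayan2009, p. 3]
[cite: CuneoEckmannHairerReyBellet2018, Thm 2.13 (3)] -/
theorem stub_kuboLink :
    ∀ (ω₂ lam β γ : ℝ) (μ : (N : ℕ) → ℝ → ℝ → Measure (PhaseSpace N)) (T : ℝ) (D : ℕ → ℝ),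
      0 < ω₂ → 0 < lam → 0 < β → 0 < γ → 0 < T →
      (∀ (N : ℕ) (T_L T_R : ℝ), 0 < T_L → 0 < T_R → ∀ ρ ρ' : Measure (PhaseSpace N),
        (pinnedChain ω₂ lam β γ).IsSteadyState N T_L T_R ρ →
        (pinnedChain ω₂ lam β γ).IsSteadyState N T_L T_R ρ' → ρ = ρ') →
      (∀ (N : ℕ) (T_L T_R : ℝ), 0 < T_L → 0 < T_R →
        (pinnedChain ω₂ lam β γ).IsSteadyState N T_L T_R (μ N T_L T_R)) →
      (∀ N : ℕ, Tendsto (fun δ : ℝ =>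
        (pinnedChain ω₂ lam β γ).totalCurrent (μ N (T + δ / 2) (T - δ / 2)) / δ) (𝓝[≠] 0) (𝓝 (D N))) →
      ∀ L : ℕ, 2 ≤ L → ∀ g : PhaseSpace L → ℝ, ContDiff ℝ 2 g →
        MemLp g 2 ((pinnedChain ω₂ lam β γ).gibbsMeasure L T) →
        ∫ x, g x ∂((pinnedChain ω₂ lam β γ).gibbsMeasure L T) = 0 →
        (∀ x, (pinnedChain ω₂ lam β γ).generator L T T g x = -(kin L 0 x - T)) →
        D L / ((L : ℝ) - 1) =
          γ * (1 - γ / T ^ 2 * ∫ x, g x * (kin L 0 x - T) ∂((pinnedChain ω₂ lam β γ).gibbsMeasure L T)) := by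
  intro ω₂ lam β γ μ T D hω hl hβ hγ hT hU hμ hD L hL2 g hgC hgL2 hg0 hgeq
  obtain ⟨δ₀, ϑ, Cm, c, hδ₀, hδ₀T, hϑ, hϑT, h2ϑ, hCm, hc, hUM⟩ :=
    Summit.AtomisticToContinuum.FouriersLaw.Theorems.OddSectorIrreversibility.Corrector.pinnedChain_uniformMixing
      (N := L) hω hl.le hβ hγ (by omega) hT
  exact stub_kuboLink_of_uniformMixingAt μ D hω hl hβ hγ hT hU hμ hL2 (hD L) hδ₀ hδ₀T hϑ hϑT h2ϑ hCm hc
    hUM hgC hgL2 hg0 hgeq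

/-- The Kubo link as a consequence for the WHOLE response sequence: under the crux's hypotheses, for every
`L ≥ 2` the response coefficient is the Kubo functional of ANY classical left forward field,
`D_L = (L−1)·γ(1 − (γ/T²)⟨g, p_0² − T⟩_{μ_T})` (division-free form of `stub_kuboLink`). [cite: ReyBellet2003, Rem. 4.4] -/
theorem response_eq_kuboFunctional
    {ω₂ lam β γ : ℝ} {μ : (N : ℕ) → ℝ → ℝ → Measure (PhaseSpace N)} {T : ℝ} {D : ℕ → ℝ}
    (hω : 0 < ω₂) (hl : 0 < lam) (hβ : 0 < β) (hγ : 0 < γ) (hT : 0 < T)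
    (hU : ∀ (N : ℕ) (T_L T_R : ℝ), 0 < T_L → 0 < T_R → ∀ ρ ρ' : Measure (PhaseSpace N),
        (pinnedChain ω₂ lam β γ).IsSteadyState N T_L T_R ρ →
        (pinnedChain ω₂ lam β γ).IsSteadyState N T_L T_R ρ' → ρ = ρ')
    (hμ : ∀ (N : ℕ) (T_L T_R : ℝ), 0 < T_L → 0 < T_R →
        (pinnedChain ω₂ lam β γ).IsSteadyState N T_L T_R (μ N T_L T_R))
    (hD : ∀ N : ℕ, Tendsto (fun δ : ℝ =>
        (pinnedChain ω₂ lam β γ).totalCurrent (μ N (T + δ / 2) (T - δ / 2)) / δ) (𝓝[≠] 0) (𝓝 (D N)))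
    {L : ℕ} (hL2 : 2 ≤ L) {g : PhaseSpace L → ℝ} (hgC : ContDiff ℝ 2 g)
    (hgL2 : MemLp g 2 ((pinnedChain ω₂ lam β γ).gibbsMeasure L T))
    (hg0 : ∫ x, g x ∂((pinnedChain ω₂ lam β γ).gibbsMeasure L T) = 0)
    (hgeq : ∀ x, (pinnedChain ω₂ lam β γ).generator L T T g x = -(kin L 0 x - T)) :
    D L = ((L : ℝ) - 1) *
      (γ * (1 - γ / T ^ 2 * ∫ x, g x * (kin L 0 x - T) ∂((pinnedChain ω₂ lam β γ).gibbsMeasure L T))) := by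
  have h := stub_kuboLink ω₂ lam β γ μ T D hω hl hβ hγ hT hU hμ hD L hL2 g hgC hgL2 hg0 hgeq
  have hLpos : (0 : ℝ) < (L : ℝ) - 1 := by
    have : (2 : ℝ) ≤ L := by exact_mod_cast hL2
    linarith
  rw [← h]
  field_simp

end Summit.AtomisticToContinuum.FouriersLaw.Cruxes.ConductanceLowerBound.ForecastSensitivity

end
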